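import Literature.NumberTheory.EllipticCurves.HeightsBaseChangeProofs
import Literature.NumberTheory.EllipticCurves.BSDInvariantsRegulatorProofs
import Literature.NumberTheory.EllipticCurves.IsogenyLocalPointsMaps
import Literature.NumberTheory.EllipticCurves.VariableChangePointsMap
import HarnessLib

/-!
# Route `SchneiderFreeAdditiveX3` (K1 door), crux `GordTwoBranchIMC` (stmt-BirchSwinnertonDyer-19177):
# canonical heights along the twist isomorphism — the untwisting `ι_θ` over a field `L ∋ √d`
# with the AMBIENT decidability instance, its Galois behaviour, and `ĥ`-invariance

Cell `bsd-schneider-ideate`, seat `bsd-schneider-door-c3` (prover, generation 5). HONEST FRAMING: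
elementary lemmas (no elliptic-curve arithmetic beyond the tree's change-of-variables API) serving
the height-transport link (L2) of the rebased road (`…BranchIMCRebaseHeight.lean`). The tree's
`untwistEquivAt` (`IsogenyLocalPointsMaps`) is built with the classical decidability instance of the
abstract field; for the concrete ring class field `K[c] ⊂ ℂ` the group law on `E(K[c])` is
elaborated with the subtype's instance, so the untwisting `(x, y) ↦ (x/θ², y/θ³)` is re-assembled
here as `congrEquiv (untwistAt_smul_eq) ∘ pointEquiv (untwistAt hθ)` with the ambient instance, and
its three properties re-run verbatim from the tree: the formula on affine points, (anti)commutation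
with `f_*` for `f θ = ±θ′` (`map_untwist_of_eq` / `_of_eq_neg` / `map_untwist_symm_of_eq_units`),
and invariance of the canonical height (`canonicalHeight_untwist_symm`; also under `congrEquiv` and
`pointEquivBaseChange`). NOTHING is asserted about BSD; `--supports` material for item 19177.

References: Silverman AEC III.1, VIII.9.1, X.2 Prop. 2.4, X.5 Cor. 5.4.
-/

noncomputable section

open scoped Classical

open WeierstrassCurve

-- D-0017 layout: summit = sub-problem, so `Summit.BirchSwinnertonDyer.BirchSwinnertonDyer.…` is the
-- mandated namespace (same option as the route's sockets files).
set_option linter.dupNamespace false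
set_option autoImplicit false

universe u

namespace Summit.BirchSwinnertonDyer.BirchSwinnertonDyer.Theorems.SchneiderFree

/-! ## §1 Canonical heights along the isomorphisms of the tree; the untwisting over a field `L ∋ √d` -/

section Heights

variable {L : Type u} [Field L] [DecidableEq L]

/-- `ĥ` is unchanged by the transport along an equality of Weierstrass equations. [folklore] -/
theorem canonicalHeight_congrEquiv [Height.AdmissibleAbsValues L] {W₁ W₂ : WeierstrassCurve L}
    (h : W₁ = W₂) (P : W₁.toAffine.Point) :
    (Affine.Point.congrEquiv h P).canonicalHeight = P.canonicalHeight := by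
  subst h
  rfl

/-- `ĥ` is unchanged by a change of variables defined over the base field `F` and read over `L`
(`VariableChange.pointEquivBaseChange`). [cite: SilvermanAEC2009, Prop. VIII.9.1] -/
theorem canonicalHeight_pointEquivBaseChange [Height.AdmissibleAbsValues L] {F : Type*} [Field F]
    [Algebra F L] (X : WeierstrassCurve F) (C : VariableChange F)
    (P : (X.baseChange L).toAffine.Point) :
    (VariableChange.pointEquivBaseChange X C L P).canonicalHeight = P.canonicalHeight := by
  rw [VariableChange.pointEquivBaseChange, AddEquiv.trans_apply, canonicalHeight_congrEquiv,
    VariableChange.pointEquiv_apply]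
  -- the tree's `canonicalHeight_pointEquiv` (any decidability instance: both sides are `pointMap`)
  have h := Affine.Point.canonicalHeight_pointEquiv (W := X.baseChange L) (C.map (algebraMap F L)) P
  rwa [VariableChange.pointEquiv_apply] at h

variable {F : Type*} [Field F] [Algebra F L] [NeZero (2 : F)] (V : WeierstrassCurve F)
  [V.IsCharNeTwoNF] {d : F} {θ : L} (hθ2 : θ ^ 2 = algebraMap F L d) (hθ : θ ≠ 0)

/-- The untwisting isomorphism `ι_θ : V^{(d)}(L) ≃ V(L)`, `(x, y) ↦ (x/θ², y/θ³)`, on an affine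
point — the tree's `untwistEquivAt_some`, re-run for the composite
`congrEquiv ∘ pointEquiv (untwistAt)` with the ambient decidability instance of `L`. [folklore] -/
theorem congrEquiv_pointEquiv_untwistAt_some {x y : L}
    (h : ((V.quadraticTwist d).baseChange L).toAffine.Nonsingular x y) :
    ∃ h', Affine.Point.congrEquiv (untwistAt_smul_eq V hθ2 hθ)
        (VariableChange.pointEquiv ((V.quadraticTwist d).baseChange L) (untwistAt hθ)
          (.some x y h)) =
      (.some ((θ ^ 2)⁻¹ * x) ((θ ^ 3)⁻¹ * y) h' : (V.baseChange L).toAffine.Point) := by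
  have h' : (V.baseChange L).toAffine.Nonsingular ((θ ^ 2)⁻¹ * x) ((θ ^ 3)⁻¹ * y) := by
    rw [← toX_untwistAt hθ, ← toY_untwistAt hθ x y, ← untwistAt_smul_eq V hθ2 hθ,
      VariableChange.nonsingular_iff]
    exact h
  refine ⟨h', ?_⟩
  rw [VariableChange.pointEquiv_some, Affine.Point.congrEquiv_some]
  simp only [Affine.Point.some.injEq]
  exact ⟨toX_untwistAt hθ x, toY_untwistAt hθ x y⟩

/-- `ĥ` is unchanged by the inverse untwisting `ι_θ⁻¹`. [cite: SilvermanAEC2009, Prop. VIII.9.1] -/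
theorem canonicalHeight_untwist_symm [Height.AdmissibleAbsValues L] (Q : (V.baseChange L).toAffine.Point) :
    ((VariableChange.pointEquiv ((V.quadraticTwist d).baseChange L) (untwistAt hθ)).symm
        ((Affine.Point.congrEquiv (untwistAt_smul_eq V hθ2 hθ)).symm Q)).canonicalHeight =
      Q.canonicalHeight := by
  set P := (VariableChange.pointEquiv ((V.quadraticTwist d).baseChange L) (untwistAt hθ)).symm
    ((Affine.Point.congrEquiv (untwistAt_smul_eq V hθ2 hθ)).symm Q) with hP
  have hQ : Q = Affine.Point.congrEquiv (untwistAt_smul_eq V hθ2 hθ)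
      (VariableChange.pointEquiv ((V.quadraticTwist d).baseChange L) (untwistAt hθ) P) := by
    rw [hP, AddEquiv.apply_symm_apply, AddEquiv.apply_symm_apply]
  rw [hQ, canonicalHeight_congrEquiv, VariableChange.pointEquiv_apply]
  have h := Affine.Point.canonicalHeight_pointEquiv (W := (V.quadraticTwist d).baseChange L)
    (untwistAt hθ) P
  rw [VariableChange.pointEquiv_apply] at h
  exact h.symm

variable {L' : Type*} [Field L'] [DecidableEq L'] [Algebra F L'] {θ' : L'}
  (hθ'2 : θ' ^ 2 = algebraMap F L' d) (hθ' : θ' ≠ 0)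

/-- `ι` commutes with `f_*` when `f θ = θ'` (tree `map_untwistEquivAt_of_eq`, re-run). [folklore] -/
theorem map_untwist_of_eq (f : L →ₐ[F] L') (hf : f θ = θ')
    (P : ((V.quadraticTwist d).baseChange L).toAffine.Point) :
    Affine.Point.map f (Affine.Point.congrEquiv (untwistAt_smul_eq V hθ2 hθ)
        (VariableChange.pointEquiv ((V.quadraticTwist d).baseChange L) (untwistAt hθ) P)) =
      Affine.Point.congrEquiv (untwistAt_smul_eq V hθ'2 hθ')
        (VariableChange.pointEquiv ((V.quadraticTwist d).baseChange L') (untwistAt hθ')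
          (Affine.Point.map f P)) := by
  rcases P with _ | ⟨x, y, h⟩
  · simp only [← Affine.Point.zero_def, map_zero]
  · obtain ⟨h₁, e₁⟩ := congrEquiv_pointEquiv_untwistAt_some V hθ2 hθ h
    obtain ⟨h₂, e₂⟩ := congrEquiv_pointEquiv_untwistAt_some V hθ'2 hθ'
      ((Affine.baseChange_nonsingular (W := V.quadraticTwist d) f.injective x y).mpr h)
    rw [e₁, Affine.Point.map_some, Affine.Point.map_some, e₂]
    congr 1 <;> simp only [map_mul, map_inv₀, map_pow, hf]

/-- `ι` anticommutes with `f_*` when `f θ = -θ'` (tree `map_untwistEquivAt_of_eq_neg`, re-run).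
[folklore] -/
theorem map_untwist_of_eq_neg (f : L →ₐ[F] L') (hf : f θ = -θ')
    (P : ((V.quadraticTwist d).baseChange L).toAffine.Point) :
    Affine.Point.map f (Affine.Point.congrEquiv (untwistAt_smul_eq V hθ2 hθ)
        (VariableChange.pointEquiv ((V.quadraticTwist d).baseChange L) (untwistAt hθ) P)) =
      -Affine.Point.congrEquiv (untwistAt_smul_eq V hθ'2 hθ')
        (VariableChange.pointEquiv ((V.quadraticTwist d).baseChange L') (untwistAt hθ')
          (Affine.Point.map f P)) := by
  rcases P with _ | ⟨x, y, h⟩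
  · simp only [← Affine.Point.zero_def, map_zero, neg_zero]
  · obtain ⟨h₁, e₁⟩ := congrEquiv_pointEquiv_untwistAt_some V hθ2 hθ h
    obtain ⟨h₂, e₂⟩ := congrEquiv_pointEquiv_untwistAt_some V hθ'2 hθ'
      ((Affine.baseChange_nonsingular (W := V.quadraticTwist d) f.injective x y).mpr h)
    rw [e₁, Affine.Point.map_some, Affine.Point.map_some, e₂, Affine.Point.neg_some]
    congr 1
    · simp only [map_mul, map_inv₀, map_pow, hf, Even.neg_pow (by decide : Even 2)]
    · simp only [negY_baseChange_of_isCharNeTwoNF', map_mul, map_inv₀, map_pow, hf,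
        Odd.neg_pow (by decide : Odd 3), inv_neg, neg_mul]

/-- `ι⁻¹` (anti)commutes with `f_*`: if `f θ = ε θ'` with `ε = ±1` then
`f_*(ι_θ⁻¹ Q) = ε · ι_{θ'}⁻¹(f_* Q)`. [folklore] -/
theorem map_untwist_symm_of_eq_units (f : L →ₐ[F] L') (ε : ℤˣ) (hf : f θ = ((ε : ℤ) : L') * θ')
    (Q : (V.baseChange L).toAffine.Point) :
    Affine.Point.map f ((VariableChange.pointEquiv ((V.quadraticTwist d).baseChange L)
        (untwistAt hθ)).symm ((Affine.Point.congrEquiv (untwistAt_smul_eq V hθ2 hθ)).symm Q)) =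
      (ε : ℤ) • (VariableChange.pointEquiv ((V.quadraticTwist d).baseChange L') (untwistAt hθ')).symm
        ((Affine.Point.congrEquiv (untwistAt_smul_eq V hθ'2 hθ')).symm (Affine.Point.map f Q)) := by
  set P := (VariableChange.pointEquiv ((V.quadraticTwist d).baseChange L) (untwistAt hθ)).symm
    ((Affine.Point.congrEquiv (untwistAt_smul_eq V hθ2 hθ)).symm Q) with hP
  have hQ : Q = Affine.Point.congrEquiv (untwistAt_smul_eq V hθ2 hθ)
      (VariableChange.pointEquiv ((V.quadraticTwist d).baseChange L) (untwistAt hθ) P) := by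
    rw [hP, AddEquiv.apply_symm_apply, AddEquiv.apply_symm_apply]
  -- apply `ι_{θ'}` to both sides
  apply (VariableChange.pointEquiv ((V.quadraticTwist d).baseChange L') (untwistAt hθ')).injective
  apply (Affine.Point.congrEquiv (untwistAt_smul_eq V hθ'2 hθ')).injective
  rw [map_zsmul, map_zsmul, AddEquiv.apply_symm_apply, AddEquiv.apply_symm_apply, hQ]
  rcases Int.units_eq_one_or ε with rfl | rfl
  · rw [Units.val_one, one_smul]
    exact (map_untwist_of_eq V hθ2 hθ hθ'2 hθ' f (by simpa using hf) P).symm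
  · rw [Units.val_neg, Units.val_one, neg_smul, one_smul]
    have hf' : f θ = -θ' := by simpa using hf
    rw [map_untwist_of_eq_neg V hθ2 hθ hθ'2 hθ' f hf' P, neg_neg]

end Heights


end Summit.BirchSwinnertonDyer.BirchSwinnertonDyer.Theorems.SchneiderFree

end
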